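import Summits.BirchSwinnertonDyer.Rank1Residual.Additive.GordTorsionAnomalousThree
import HarnessLib

/-!
# The ANOMALOUS BIT at `p = 3` is ONE RESIDUE of Cremona's `c₆`: on the (G)-cell at `3`,
# `c₆(E) ≡ 27·b₂(E^{(−3)}) (mod 81)`, so anomalous ⟺ `c₆ ≡ 27 (mod 81)`, ordinary ⟺ `81 ∤ c₆`,
# and a `3`-torsion point forces `c₆ ≡ 27 (mod 81)` (gen 39's LAW R3 as a theorem)

HONEST FRAMING (cell `b2b-bsdres`, run/shared/lean/b2b/bsd-rank1-residual/, verbatim in every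
file): the goal of the cell is to DELETE the COMBINATION-SHAPED residual classes of the
Birch–Swinnerton-Dyer formula for ALL analytic-rank `≤ 1` elliptic curves over `ℚ` — "full BSD
formula for every rank `≤ 1` curve in class `C`" assembled STRICTLY from published theorems — so
that the rank-`≤ 1` remainder becomes exactly the CONSTRUCTION-SHAPED classes, which are TYPED
(missing-input `Prop`s), NOT attempted. This is not "finishing BSD". Sub-cell `additive-p2`
(X3♯(G-ord) / X4♯(G-ord)), generation 39: research route; no claim beyond the stated classes;
theorems only, no definition, no named fact, nothing booked, no label moved.

## What and why

Generation 36 (`Additive/GordAnomalousResidueFour/ThreeSix`) DECIDED Delbourgo's proviso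
`ReductionNonAnomalous W p` on the defect-`3/4/6` part of the (G)-cell by ONE residue of Cremona's
`(c₄, c₆)` (`c₄/(−5) ≡ 1 (mod 5)`, `c₆/(−7)^v ≡ −1 (mod 7)`, …); on DEFECT 2 it was left in the form
"`a_p(E^{(p*)}) ≢ 1 (mod p)`" (n1011-p10, `Additive/ReductionNonAnomalousTwist`), a datum of the TWIST.
At `p = 3` the whole (G)-cell is defect `2`, and this file converts the datum to the curve's OWN `c₆`:

* **`sq_sq_dvd_c₆_sub_of_model_twist`** — `W`, `V` globally minimal over `ℚ`, `C • V^{(−3)} = W`,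
  `3 ∤ Δ_min(V)`, `ord₃ Δ_min(W) = 6`: **`81 ∣ c₆(W_ℤ) − 27·b₂(V_ℤ)`** (`c₆(W) = u⁻⁶·(−27)·c₆(V)` with
  `u` a `3`-adic unit by the discriminants, `u⁻⁶ ≡ 1`, `c₆(V) ≡ −b₂(V)³ ≡ −b₂(V) (mod 3)`);
* on the (G)-cell at `3` (`TypeG W 3`, `Addv W 3`; `ord₃ Δ_min = 6` by `Additive/TypeGThree`), with
  generation 39's `a₃(V) ≡ b₂(V) (mod 3)` (`Additive/AnomalousPointCountThree`) and n1011-p10's dictionary: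
  **`TypeG.reductionNonAnomalous_three_iff_not_dvd_c₆_sub`**: `ReductionNonAnomalous W 3 ⟺ ¬ 81 ∣ c₆(W_ℤ) − 27`
  (ANOMALOUS ⟺ `c₆ ≡ 27 (mod 81)` ⟺ `c₆/(−3)³ ≡ −1 (mod 3)` — the shape of gen 36's LAW 7);
  **`TypeG.typeGOrd_three_iff_not_dvd_c₆`**: `TypeGOrd W 3 ⟺ ¬ 81 ∣ c₆(W_ℤ)` (the twist is
  ORDINARY iff `ord₃ c₆ = 3`);
* with generation 39's torsion theorem: **`TypeG.sq_sq_dvd_c₆_sub_of_prime_zsmul_eq_zero`** — a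
  `ℚ₃`-point `P ≠ O` with `3 • P = O` on a (G)-pair at `3` forces **`81 ∣ c₆(W_ℤ) − 27`**, the
  literal twin of generation 38's `49 ∣ c₆ − 7` at `7` and `25 ∣ c₄ + 5` at `5`; census forms
  `TypeG.eq_zero_of_three_nsmul_eq_zero_of_not_dvd_c₆_sub` (`¬ 81 ∣ c₆ − 27 ⟹ E(ℚ₃)[3] = 0`) and
  `…padicValNat_torsionOrder_three_eq_zero_of_not_dvd_c₆_sub` (`⟹ t = 0`), class forms for
  X3♯(G-ord) / X4♯(G-ord).

EVIDENCE (generation 39, `gen39/TORSION-THREE-READING.md`, zero compute, whole Cremona table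
N < 5·10⁵): on the 117 867 (G)@3 pairs `c₆ mod 81` is `27` on exactly the 38 854 anomalous rows, `54`
on the 36 212 ordinary non-anomalous rows and `0` on exactly the 42 801 supersingular-twist rows —
now a theorem.

References: [Delbourgo2002] D. Delbourgo, J. Number Theory 95 (2002), p. 39 (`ℓ_p(E)`);
[Mazur1972] B. Mazur, Invent. Math. 18 (1972) §1; [SilvermanAEC2009] III.1 (`c₆`, `Δ` under
`u`), X.5.4 (twists), VII.1 (minimal discriminant); [Mazur1977] Ch. III §5, Step 1, p. 158 (method).
-/

noncomputable section

open scoped Classical NumberField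

namespace Summit.BirchSwinnertonDyer.Rank1Residual.Additive

open WeierstrassCurve IsDedekindDomain NumberField Literature.NumberTheory.EllipticCurves
  Literature.NumberTheory.EllipticCurves.Rank1Residual AdditivePotMult

/-! ## §1 Two finite checks over `𝔽₃` -/

/-- In `𝔽₃`: for a unit `u` and any `b₂, b₄, b₆`, `u⁶·(−b₂³ + 36b₂b₄ − 216b₆) + b₂ = 0`
(`u⁶ = 1`, `36 = 216 = 0`, `b₂³ = b₂`): the residue of `u⁶·c₆ + b₂`. [folklore] -/
theorem zmod_three_unit_pow_six_mul_c₆_add_b₂ :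
    ∀ b₂ b₄ b₆ u : ZMod 3, u ≠ 0 → u ^ 6 * (-b₂ ^ 3 + 36 * b₂ * b₄ - 216 * b₆) + b₂ = 0 := by
  decide

/-! ## §2 `c₆(E) ≡ 27·b₂(E^{(−3)}) (mod 81)` for a twist model good at `3` -/

variable (W : WeierstrassCurve ℚ) [W.IsElliptic] [W.IsGloballyMinimal] (V : WeierstrassCurve ℚ)
  [V.IsElliptic] [V.IsGloballyMinimal]

omit [W.IsElliptic] in
/-- **`W ≅ V^{(−3)}` over `ℚ`, both globally minimal, `3 ∤ Δ_min(V)`, `ord₃ Δ_min(W) = 6` ⟹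
`81 ∣ c₆(W_ℤ) − 27·b₂(V_ℤ)`.** With `C • V^{(−3)} = W` and `u = C.u`: `c₆(W) = u⁻⁶·(−3)³·c₆(V)`,
`Δ(W) = u⁻¹²·3⁶·Δ(V)`, so `ord₃ u = 0`; in `ℤ₃`, `u⁻⁶ ≡ 1 (mod 3)` and
`c₆(V) = −b₂³ + 36b₂b₄ − 216b₆ ≡ −b₂ (mod 3)`, whence `c₆(W) − 27b₂(V) = −27(u⁻⁶c₆(V) + b₂(V)) ∈ 81ℤ₃`.
[cite: SilvermanAEC2009, III.1 Table 3.1 (u-scaling of c₆, Δ) and X.5 Cor. 5.4] -/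
theorem sq_sq_dvd_c₆_sub_of_model_twist [Fact (Nat.Prime 3)]
    (hWV : ∃ C : VariableChange ℚ, C • V.quadraticTwist (-3) = W)
    (hV : ¬ (3 : ℤ) ∣ minimalDiscriminantInt V) (hW : padicValInt 3 (minimalDiscriminantInt W) = 6) :
    (81 : ℤ) ∣ (integralModelInt W).c₆ - 27 * (integralModelInt V).b₂ := by
  obtain ⟨C, hC⟩ := hWV
  set w : ℚ := ((C.u⁻¹ : ℚˣ) : ℚ) with hw
  have hw0 : w ≠ 0 := (C.u⁻¹).ne_zero
  set E₀ : WeierstrassCurve ℤ := integralModelInt V with hE₀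
  -- the scaling relations over `ℚ`
  have R1 : ((integralModelInt W).c₆ : ℚ) = w ^ 6 * ((-3) ^ 3 * (E₀.c₆ : ℚ)) := by
    rw [← c₆_eq_intCast_integralModelInt W, hE₀, ← c₆_eq_intCast_integralModelInt V, ← hC,
      variableChange_c₆, quadraticTwist_c₆]
  have R2 : ((minimalDiscriminantInt W : ℤ) : ℚ) = w ^ 12 * ((-3) ^ 6 * (minimalDiscriminantInt V : ℚ)) := by
    rw [cast_minimalDiscriminantInt, cast_minimalDiscriminantInt, ← hC, variableChange_Δ,
      quadraticTwist_Δ]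
  -- `ord₃ w = 0`
  have hΔV0 : (minimalDiscriminantInt V : ℚ) ≠ 0 := by exact_mod_cast minimalDiscriminantInt_ne_zero V
  have hvw : padicValRat 3 w = 0 := by
    have h := congrArg (padicValRat 3) R2
    rw [padicValRat.of_int, hW, padicValRat.mul (pow_ne_zero _ hw0) (mul_ne_zero (by norm_num) hΔV0),
      padicValRat.mul (by norm_num) hΔV0, padicValRat.pow, padicValRat.of_int,
      padicValInt.eq_zero_of_not_dvd hV, show ((-3 : ℚ)) ^ 6 = (3 : ℚ) ^ 6 by norm_num,
      padicValRat.pow, show (3 : ℚ) = ((3 : ℕ) : ℚ) by norm_num,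
      padicValRat.self (by norm_num : 1 < 3)] at h
    push_cast at h
    omega
  have hnw : ‖(w : ℚ_[3])‖ = 1 := by
    rw [Padic.eq_padicNorm, padicNorm.eq_zpow_of_nonzero hw0, hvw, neg_zero, zpow_zero, Rat.cast_one]
  -- `w` as a `3`-adic unit
  set w₀ : ℤ_[3] := ⟨(w : ℚ_[3]), hnw.le⟩ with hw₀
  have hw₀w : (w₀ : ℚ_[3]) = (w : ℚ_[3]) := rfl
  have hφw : PadicInt.toZMod w₀ ≠ 0 := by
    intro h0
    have h1 : ‖w₀‖ < 1 :=
      (PadicInt.norm_lt_one_iff_dvd w₀).mpr (by simpa using (TorsionThree.toZMod_eq_zero_iff_three_dvd w₀).mp h0)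
    have h2 : ‖w₀‖ = 1 := hnw
    rw [h2] at h1
    exact lt_irrefl _ h1
  -- the residue of `u⁻⁶ c₆(V) + b₂(V)`
  set z : ℤ_[3] := w₀ ^ 6 * (E₀.c₆ : ℤ_[3]) + (E₀.b₂ : ℤ_[3]) with hz
  have hz3 : (3 : ℤ_[3]) ∣ z := by
    refine (TorsionThree.toZMod_eq_zero_iff_three_dvd z).mp ?_
    have hc₆ : (E₀.c₆ : ℤ_[3]) = -(E₀.b₂ : ℤ_[3]) ^ 3 + 36 * (E₀.b₂ : ℤ_[3]) * (E₀.b₄ : ℤ_[3]) -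
        216 * (E₀.b₆ : ℤ_[3]) := by
      rw [WeierstrassCurve.c₆]; push_cast; ring
    have key := zmod_three_unit_pow_six_mul_c₆_add_b₂ (PadicInt.toZMod (E₀.b₂ : ℤ_[3]))
      (PadicInt.toZMod (E₀.b₄ : ℤ_[3])) (PadicInt.toZMod (E₀.b₆ : ℤ_[3])) (PadicInt.toZMod w₀) hφw
    rw [hz, hc₆]
    simpa only [map_add, map_mul, map_pow, map_sub, map_neg, map_ofNat] using key
  obtain ⟨z', hz'⟩ := hz3
  -- `c₆(W) − 27 b₂(V) = −81 z'` in `ℚ₃`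
  have hQ : (((integralModelInt W).c₆ - 27 * E₀.b₂ : ℤ) : ℚ_[3]) = -81 * (z' : ℚ_[3]) := by
    have R1' : (((integralModelInt W).c₆ : ℤ) : ℚ_[3]) =
        (w : ℚ_[3]) ^ 6 * ((-3) ^ 3 * ((E₀.c₆ : ℤ) : ℚ_[3])) := by
      have h := congrArg (fun q : ℚ => (q : ℚ_[3])) R1
      push_cast at h
      exact h
    have hzQ : ((z : ℤ_[3]) : ℚ_[3]) = (w : ℚ_[3]) ^ 6 * ((E₀.c₆ : ℤ) : ℚ_[3]) + ((E₀.b₂ : ℤ) : ℚ_[3]) := by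
      rw [hz]; push_cast; rw [hw₀w]
    have h3 : ((3 : ℤ_[3]) : ℚ_[3]) = 3 := map_ofNat PadicInt.Coe.ringHom 3
    have hz'Q : ((z : ℤ_[3]) : ℚ_[3]) = 3 * ((z' : ℤ_[3]) : ℚ_[3]) := by
      rw [hz', PadicInt.coe_mul, h3]
    push_cast
    rw [R1']
    linear_combination (-27 : ℚ_[3]) * (hzQ.symm.trans hz'Q)
  have hnorm : ‖(((integralModelInt W).c₆ - 27 * E₀.b₂ : ℤ) : ℚ_[3])‖ ≤ (3 : ℝ) ^ (-(4 : ℕ) : ℤ) := by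
    rw [hQ, norm_mul, show (-81 : ℚ_[3]) = -((3 : ℕ) : ℚ_[3]) ^ 4 by norm_num, norm_neg, norm_pow,
      Padic.norm_p]
    have h1 : ‖((z' : ℤ_[3]) : ℚ_[3])‖ ≤ 1 := PadicInt.norm_le_one z'
    have h3 : (0 : ℝ) ≤ ((3 : ℕ) : ℝ)⁻¹ ^ 4 := by positivity
    calc ((3 : ℕ) : ℝ)⁻¹ ^ 4 * ‖((z' : ℤ_[3]) : ℚ_[3])‖ ≤ ((3 : ℕ) : ℝ)⁻¹ ^ 4 * 1 :=
          mul_le_mul_of_nonneg_left h1 h3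
      _ = (3 : ℝ) ^ (-(4 : ℕ) : ℤ) := by norm_num
  have h81 := (Padic.norm_int_le_pow_iff_dvd _ 4).mp hnorm
  norm_num at h81
  exact h81

/-! ## §3 The (G)-cell at `3`: the anomalous bit and the ordinary bit are residues of `c₆` -/

variable {W}

/-- **On the (G)-cell at `3`: `ReductionNonAnomalous W 3 ⟺ ¬ 81 ∣ c₆(W_ℤ) − 27`** — ANOMALOUS over
`ℚ(√−3)` iff `c₆ ≡ 27 (mod 81)` (`⟺ c₆/(−3)³ ≡ −1 (mod 3)`, the shape of gen 36's LAW 7 at `7`).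
The twist `V ≅ E^{(−3)}` is good at `3`, the reduction over `ℚ(√−3)` is `Ṽ`
(`reductionNonAnomalous_iff_of_semistabilityIndex_eq_two`), `3 ∣ #Ṽ(𝔽₃) ⟺ 3 ∣ b₂(V_ℤ) − 1`
(`Additive/AnomalousPointCountThree`), and `c₆(W_ℤ) ≡ 27 b₂(V_ℤ) (mod 81)` (§2).
[cite: Delbourgo2002, p. 39 (definition of ℓ_p(E)); Mazur1972, §1 (anomalous primes)] -/
theorem TypeG.reductionNonAnomalous_three_iff_not_dvd_c₆_sub [Fact (Nat.Prime 3)] (hG : TypeG W 3)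
    (hadd : Addv W 3) :
    Delbourgo2002.ReductionNonAnomalous W 3 ↔ ¬ (81 : ℤ) ∣ (integralModelInt W).c₆ - 27 := by
  have hd : ((-1 : ℚ) ^ ((3 : ℕ) / 2) * (3 : ℕ)) ≠ 0 := by norm_num
  obtain ⟨V, iV, iVm, C₁, hC₁⟩ := exists_globallyMinimal_model_twist W hd
  have hV : V.HasGoodReductionAtPrime 3 :=
    hasGoodReductionAtPrime_twist_three_of_typeG_of_addv W hG hadd V ⟨C₁, hC₁⟩
  obtain ⟨C, hC⟩ := exists_variableChange_twist_of_model_twist W hd hC₁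
  have hC' : ∃ C : VariableChange ℚ, C • V.quadraticTwist (-3) = W :=
    ⟨C, by have h := hC; norm_num at h ⊢; exact h⟩
  have he := semistabilityIndex_eq_two_of_typeG_three W hG hadd
  have hΔV : ¬ (3 : ℤ) ∣ minimalDiscriminantInt V := by
    have h := not_dvd_minimalDiscriminantInt_of_hasGoodReductionAtPrime (W := V) 3 hV
    rwa [Nat.cast_ofNat] at h
  have hΔW : padicValInt 3 (minimalDiscriminantInt W) = 6 :=
    padicValInt_minimalDiscriminantInt_eq_six_of_typeG W hG hadd.1
  have key := sq_sq_dvd_c₆_sub_of_model_twist W V hC' hΔV hΔW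
  rw [reductionNonAnomalous_iff_of_semistabilityIndex_eq_two W 3 (by decide) he V ⟨C, hC⟩ hV,
    DeuringThree.three_dvd_reductionPointCount_iff_dvd_b₂_sub_one V hΔV, not_iff_not]
  constructor
  · rintro ⟨m, hm⟩
    obtain ⟨k, hk⟩ := key
    exact ⟨k + m, by linear_combination hk + 27 * hm⟩
  · rintro ⟨m, hm⟩
    obtain ⟨k, hk⟩ := key
    have h27 : (27 : ℤ) * ((integralModelInt V).b₂ - 1) = 81 * (m - k) := by linear_combination 1 * hm - 1 * hk
    refine ⟨m - k, ?_⟩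
    have h := h27
    omega

/-- **On the (G)-cell at `3`: (G)-ORDINARY ⟺ `¬ 81 ∣ c₆(W_ℤ)`** (the good twist `E^{(−3)}` is ordinary at
`3` iff `a₃ ≢ 0`, iff `b₂(V_ℤ) ≢ 0 (mod 3)`, iff `ord₃ c₆(E) = 3`).
[cite: Delbourgo1998, §1.5 (types (G)); Mazur1972, §1] -/
theorem TypeG.typeGOrd_three_iff_not_dvd_c₆ [Fact (Nat.Prime 3)] (hG : TypeG W 3) (hadd : Addv W 3) :
    TypeGOrd W 3 ↔ ¬ (81 : ℤ) ∣ (integralModelInt W).c₆ := by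
  have hd : ((-1 : ℚ) ^ ((3 : ℕ) / 2) * (3 : ℕ)) ≠ 0 := by norm_num
  obtain ⟨V, iV, iVm, C₁, hC₁⟩ := exists_globallyMinimal_model_twist W hd
  have hV : V.HasGoodReductionAtPrime 3 :=
    hasGoodReductionAtPrime_twist_three_of_typeG_of_addv W hG hadd V ⟨C₁, hC₁⟩
  obtain ⟨C, hC⟩ := exists_variableChange_twist_of_model_twist W hd hC₁
  have hC' : ∃ C : VariableChange ℚ, C • V.quadraticTwist (-3) = W :=
    ⟨C, by have h := hC; norm_num at h ⊢; exact h⟩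
  have hΔV : ¬ (3 : ℤ) ∣ minimalDiscriminantInt V := by
    have h := not_dvd_minimalDiscriminantInt_of_hasGoodReductionAtPrime (W := V) 3 hV
    rwa [Nat.cast_ofNat] at h
  have hΔW : padicValInt 3 (minimalDiscriminantInt W) = 6 :=
    padicValInt_minimalDiscriminantInt_eq_six_of_typeG W hG hadd.1
  have key := sq_sq_dvd_c₆_sub_of_model_twist W V hC' hΔV hΔW
  have htr := DeuringThree.intCast_frobeniusTrace_three_eq_b₂ V hΔV
  rw [typeGOrd_three_iff_goodOrd_twist W hadd V C₁ hC₁, GoodOrd, and_iff_right hV]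
  -- `3 ∣ a₃(V) ⟺ 3 ∣ b₂(V_ℤ) ⟺ 81 ∣ c₆(W_ℤ)`
  have e1 : (3 : ℤ) ∣ V.frobeniusTrace 3 ↔ (3 : ℤ) ∣ (integralModelInt V).b₂ := by
    have h1 := ZMod.intCast_zmod_eq_zero_iff_dvd (V.frobeniusTrace 3) 3
    have h2 := ZMod.intCast_zmod_eq_zero_iff_dvd ((integralModelInt V).b₂) 3
    push_cast at h1 h2
    rw [← h1, ← h2, htr]
  simp only [Nat.cast_ofNat]
  rw [e1, not_iff_not]
  constructor
  · rintro ⟨m, hm⟩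
    obtain ⟨k, hk⟩ := key
    exact ⟨k + m, by linear_combination hk + 27 * hm⟩
  · rintro ⟨m, hm⟩
    obtain ⟨k, hk⟩ := key
    have h27 : (27 : ℤ) * (integralModelInt V).b₂ = 81 * (m - k) := by linear_combination 1 * hm - 1 * hk
    refine ⟨m - k, ?_⟩
    have h := h27
    omega

/-- **A `3`-torsion point on a (G)-pair at `3` forces `81 ∣ c₆(W_ℤ) − 27`** (`c₆ ≡ 27 (mod 81)`: the
literal twin of generation 38's `49 ∣ c₆ − 7` at `7` / `25 ∣ c₄ + 5` at `5`).
[cite: Mazur1977, Ch. III §5, Step 1, p. 158 (method); Delbourgo2002, p. 39 (definition of ℓ_p(E))] -/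
theorem TypeG.sq_sq_dvd_c₆_sub_of_prime_zsmul_eq_zero [Fact (Nat.Prime 3)] (hG : TypeG W 3)
    (hadd : Addv W 3) {P : (W.baseChange ℚ_[3]).toAffine.Point} (hP0 : P ≠ 0) (hP : (3 : ℤ) • P = 0) :
    (81 : ℤ) ∣ (integralModelInt W).c₆ - 27 := by
  by_contra h81
  exact hG.not_reductionNonAnomalous_three_of_prime_zsmul_eq_zero hadd hP0 hP
    ((hG.reductionNonAnomalous_three_iff_not_dvd_c₆_sub hadd).mpr h81)

/-- **Census form: on the (G)-cell at `3`, `¬ 81 ∣ c₆(W_ℤ) − 27 ⟹ E(ℚ₃)[3] = 0`** — one residue of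
Cremona's `c₆` certifies the LOCAL absence of `3`-torsion (the `htors`-shaped hypothesis of the
X11b / x1b / n1011 certificates). [cite: Mazur1977, Ch. III §5, Step 1, p. 158 (method); Delbourgo2002, p. 39] -/
theorem TypeG.eq_zero_of_three_nsmul_eq_zero_of_not_dvd_c₆_sub [Fact (Nat.Prime 3)] (hG : TypeG W 3)
    (hadd : Addv W 3) (h81 : ¬ (81 : ℤ) ∣ (integralModelInt W).c₆ - 27)
    {P : (W.baseChange ℚ_[3]).toAffine.Point} (hP : (3 : ℕ) • P = 0) : P = 0 :=
  hG.eq_zero_of_three_nsmul_eq_zero_of_reductionNonAnomalous hadd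
    ((hG.reductionNonAnomalous_three_iff_not_dvd_c₆_sub hadd).mpr h81) hP

/-- **Census form: on the (G)-cell at `3`, `¬ 81 ∣ c₆(W_ℤ) − 27 ⟹ t = ord₃ #E(ℚ)_tors = 0`.**
[cite: Mazur1977, Ch. III §5, Step 1, p. 158 (method); Delbourgo2002, p. 39 (definition of ℓ_p(E))] -/
theorem TypeG.padicValNat_torsionOrder_three_eq_zero_of_not_dvd_c₆_sub [Fact (Nat.Prime 3)]
    (hG : TypeG W 3) (hadd : Addv W 3) (h81 : ¬ (81 : ℤ) ∣ (integralModelInt W).c₆ - 27) :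
    padicValNat 3 W.torsionOrder = 0 :=
  hG.padicValNat_torsionOrder_three_eq_zero_of_reductionNonAnomalous hadd
    ((hG.reductionNonAnomalous_three_iff_not_dvd_c₆_sub hadd).mpr h81)

/-! ## §4 Class level at `3`: X3♯(G-ord), X4♯(G-ord) -/

/-- **X3♯(G-ord) at `3`: `ReductionNonAnomalous W 3 ⟺ ¬ 81 ∣ c₆(W_ℤ) − 27`** — the 'anomalous over
`F₀`' column of the census at `3` is ONE residue of Cremona's `c₆`.
[cite: Delbourgo2002, p. 39 (definition of ℓ_p(E)); Delbourgo1998, §1.5] -/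
theorem ClassX3Gord.reductionNonAnomalous_three_iff_not_dvd_c₆_sub [Fact (Nat.Prime 3)]
    (hX : ClassX3Gord W 3) :
    Delbourgo2002.ReductionNonAnomalous W 3 ↔ ¬ (81 : ℤ) ∣ (integralModelInt W).c₆ - 27 :=
  hX.2.typeG.reductionNonAnomalous_three_iff_not_dvd_c₆_sub hX.1.2

/-- **X4♯(G-ord) at `3`: `ReductionNonAnomalous W 3 ⟺ ¬ 81 ∣ c₆(W_ℤ) − 27`.**
[cite: Delbourgo2002, p. 39 (definition of ℓ_p(E)); Delbourgo1998, §1.5] -/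
theorem ClassX4Gord.reductionNonAnomalous_three_iff_not_dvd_c₆_sub [Fact (Nat.Prime 3)]
    (hX : ClassX4Gord W 3) :
    Delbourgo2002.ReductionNonAnomalous W 3 ↔ ¬ (81 : ℤ) ∣ (integralModelInt W).c₆ - 27 :=
  hX.2.typeG.reductionNonAnomalous_three_iff_not_dvd_c₆_sub hX.1.2.1

/-- **On X3♯(G-ord) / X4♯(G-ord) at `3` the curve IS (G)-ordinary, so `81 ∤ c₆(W_ℤ)`** (`ord₃ c₆ = 3`
exactly on the whole (G-ord) locus at `3`). [cite: Delbourgo1998, §1.5 (types (G)); SilvermanAEC2009, VII.1] -/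
theorem ClassX3Gord.not_dvd_c₆_three [Fact (Nat.Prime 3)] (hX : ClassX3Gord W 3) :
    ¬ (81 : ℤ) ∣ (integralModelInt W).c₆ :=
  (hX.2.typeG.typeGOrd_three_iff_not_dvd_c₆ hX.1.2).mp hX.2

/-- X4♯(G-ord) at `3`: `81 ∤ c₆(W_ℤ)`. [cite: Delbourgo1998, §1.5 (types (G)); SilvermanAEC2009, VII.1] -/
theorem ClassX4Gord.not_dvd_c₆_three [Fact (Nat.Prime 3)] (hX : ClassX4Gord W 3) :
    ¬ (81 : ℤ) ∣ (integralModelInt W).c₆ :=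
  (hX.2.typeG.typeGOrd_three_iff_not_dvd_c₆ hX.1.2.1).mp hX.2

/-- **X3♯(G-ord) at `3`: a `ℚ₃`-rational `3`-torsion point forces `c₆ ≡ 27 (mod 81)`.**
[cite: Mazur1977, Ch. III §5, Step 1, p. 158 (method); Delbourgo2002, p. 39 (definition of ℓ_p(E))] -/
theorem ClassX3Gord.sq_sq_dvd_c₆_sub_of_prime_zsmul_eq_zero [Fact (Nat.Prime 3)] (hX : ClassX3Gord W 3)
    {P : (W.baseChange ℚ_[3]).toAffine.Point} (hP0 : P ≠ 0) (hP : (3 : ℤ) • P = 0) :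
    (81 : ℤ) ∣ (integralModelInt W).c₆ - 27 :=
  hX.2.typeG.sq_sq_dvd_c₆_sub_of_prime_zsmul_eq_zero hX.1.2 hP0 hP

/-- X4♯(G-ord) at `3`: a `ℚ₃`-rational `3`-torsion point forces `c₆ ≡ 27 (mod 81)`.
[cite: Mazur1977, Ch. III §5, Step 1, p. 158 (method); Delbourgo2002, p. 39 (definition of ℓ_p(E))] -/
theorem ClassX4Gord.sq_sq_dvd_c₆_sub_of_prime_zsmul_eq_zero [Fact (Nat.Prime 3)] (hX : ClassX4Gord W 3)
    {P : (W.baseChange ℚ_[3]).toAffine.Point} (hP0 : P ≠ 0) (hP : (3 : ℤ) • P = 0) :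
    (81 : ℤ) ∣ (integralModelInt W).c₆ - 27 :=
  hX.2.typeG.sq_sq_dvd_c₆_sub_of_prime_zsmul_eq_zero hX.1.2.1 hP0 hP

end Summit.BirchSwinnertonDyer.Rank1Residual.Additive

end
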